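import Literature.AlgebraicGeometry.Modules.SerreTwistMod
import Literature.AlgebraicGeometry.Morphisms.DevissageClass
import HarnessLib

/-!
# Serre's theorem A for the twists `G(m)` of a coherent sheaf on a closed subscheme of `𝐏ʳ_A`, in chart form

For a closed immersion `ι : Z ↪ 𝐏ʳ_A = Proj A[x₀, …, x_r]`, a coherent (`Morphisms.Coh`: affine-localizing
and of affine-finite type) sheaf of `𝒪_Z`-modules `G` and the positive twists `G(m) = twistMod ι G m` of
`Modules/SerreTwistMod` (sections over `U` = families `(n_j ∈ Γ(U ∩ Z_j, G))_j` with
`n_j = (x_{j'}/x_j)^m n_{j'}`), this file proves **Serre's theorem A** (Hartshorne II Thm. 5.17 with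
Lemma 5.14; Serre, FAC, Ch. III) in the concrete form consumed by the Čech proof of Serre's
vanishing theorem: there is `m₀` such that for every `m ≥ m₀` finitely many GLOBAL sections
`g_0, …, g_N ∈ Γ(Z, G(m))` have `i₀`-th chart values `(g_k)_{i₀}|_{Z_s}` generating `Γ(Z_s, G)` over
`Γ(Z_s, 𝒪_Z)` for every standard open `Z_s = Z ∩ D₊(Π_{i ∈ s} x_i)` and every `i₀ ∈ s`
(`SerreTwist.exists_generators`).

The proof is Hartshorne's, run on the affine charts `Z_j = Z ∩ D₊(x_j)`:

* `Zop_singleton_inf_eq_basicOpen` — `Z_j ∩ Z_i` is the basic open `D(x_i/x_j)` of the affine `Z_j`;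
  `Zop_eq_basicOpen_of_mem` — `Z_s` is a basic open of `Z_{i₀}` for `i₀ ∈ s`;
* `exists_chartData` — **extension of sections** (Lemma 5.14): for `t ∈ Γ(Z_i, G)` there are `d` and
  "chart data" `x_j ∈ Γ(Z_j, G)` with `x_j = (x_i/x_j)^d t` on `Z_j ∩ Z_i` and `x_j = (x_{j'}/x_j)^d x_{j'}`
  on `Z_j ∩ Z_{j'}` (numerators on the `Z_j`, made uniform, then corrected by the torsion property on the
  affine opens `Z_{{j,j'}}`); multiplying by `(x_i/x_j)^e` raises the degree (`numer_pow_smul`,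
  `compat_pow_smul`), and such data IS a global section of `G(d)` with `i`-th value `t`
  (`isTwistFamily_of_compat`, `exists_comp_eq_of_chartData`), whence `exists_forall_comp_eq`: `t` extends
  to `Γ(Z, G(n))` for all `n ≫ 0`;
* `exists_generators` — finite generation of `Γ(Z_i, G)` on the `r + 1` affine charts, extension of the
  generators in a common large degree, and generation on `Z_s = D(u) ⊆ Z_{i₀}` by numerators and the
  invertibility of `u` on `Z_s`.

Everything is proved; no named facts. Mathlib (this pin) has neither twisting sheaves on `Proj` nor
Serre's theorems (searched `twisting`, `Serre`, `globallyGenerated` in `Mathlib/AlgebraicGeometry`: nothing).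

## References

* R. Hartshorne, *Algebraic Geometry*, GTM 52, Springer (1977): II Lemma 5.14 (p. 118), II Thm. 5.17
  (p. 121), III Thm. 5.2 (proof). [Hartshorne1977]
* J.-P. Serre, *Faisceaux algébriques cohérents*, Ann. of Math. 61 (1955), Ch. III (coherent algebraic
  sheaves on projective space: the theorems now called A and B).
-/

noncomputable section

universe u

open CategoryTheory AlgebraicGeometry TopologicalSpace Opposite
open Literature.Algebra.Homology Literature.Algebra.Homology.LaurentCech
open Literature.AlgebraicGeometry.Morphisms Literature.AlgebraicGeometry.Morphisms.ProjCech

namespace Literature.AlgebraicGeometry.Modules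

namespace SerreTwist

variable {A : Type u} [CommRing A] {r : ℕ} {Z : Scheme.{u}} (ι : Z ⟶ PP A r) (G : Z.Modules)

/-! ## The charts: affineness and basic opens -/

/-- The standard opens `Z_s = Z ∩ D₊(X_s)`, `s ≠ ∅`, are affine when `ι` is affine (e.g. a closed
immersion): `D₊(X_s)` is affine (Mathlib `Proj.isAffineOpen_basicOpen`, for the grading of `A[x₀, …, x_r]`
by degree). [folklore] -/
theorem isAffineOpen_Zop [IsAffineHom ι] {s : Finset (Fin (r + 1))} (hs : s.Nonempty) :
    IsAffineOpen (Zop ι s) := by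
  letI : GradedAlgebra (grading A r) := MvPolynomial.gradedAlgebra
  exact (Proj.isAffineOpen_basicOpen _ _ (Xs_mem s) (Finset.card_pos.mpr hs)).preimage ι

/-- **`Z_j ∩ Z_i` is the basic open `D(x_i / x_j)` of `Z_j`.** [folklore] -/
theorem Zop_singleton_inf_eq_basicOpen (i j : Fin (r + 1)) :
    Zop ι {j} ⊓ Zop ι {i} = Z.basicOpen (chartFun ι i j) := by
  by_cases h : i = j
  · subst h
    rw [chartFun_self, Scheme.basicOpen_one, inf_idem]
  · have hsj : (({i} : Finset (Fin (r + 1))).erase j).Nonempty := by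
      rw [Finset.erase_eq_of_notMem (Finset.notMem_singleton.mpr (Ne.symm h))]
      exact Finset.singleton_nonempty i
    have key := Zop_insert_eq_basicOpen ι hsj
    rw [Finset.insert_eq, Zop_union] at key
    exact key

/-- **`Z_s` is the basic open `D(t_{s,i₀}|_Z)` of `Z_{i₀}` for `i₀ ∈ s`** (for `s = {i₀}` the function is
`1`). [folklore] -/
theorem Zop_eq_basicOpen_of_mem {s : Finset (Fin (r + 1))} {i₀ : Fin (r + 1)} (hi₀ : i₀ ∈ s) :
    Zop ι s = Z.basicOpen (show Γ(Z, Zop ι {i₀}) from evalRing ι {i₀} (tElB A s i₀)) := by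
  rcases (s.erase i₀).eq_empty_or_nonempty with h | h
  · rcases (Finset.erase_eq_empty_iff s i₀).mp h with h' | h'
    · rw [h'] at hi₀
      exact absurd hi₀ (Finset.notMem_empty i₀)
    · subst h'
      have h1 : (show Γ(Z, Zop ι {i₀}) from evalRing ι {i₀} (tElB A {i₀} i₀)) = 1 := chartFun_self ι i₀
      rw [h1, Scheme.basicOpen_one]
  · have key := Zop_insert_eq_basicOpen ι h
    rwa [Finset.insert_eq_of_mem hi₀] at key

/-- `Z_{{j} ∪ {j'}} = Z_j ∩ Z_{j'} ⊆ Z_j`. [folklore] -/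
theorem Zop_pair_le_left (j j' : Fin (r + 1)) : Zop ι ({j} ∪ {j'}) ≤ Zop ι {j} :=
  Zop_mono ι Finset.subset_union_left

/-- `Z_{{j} ∪ {j'}} = Z_j ∩ Z_{j'} ⊆ Z_{j'}`. [folklore] -/
theorem Zop_pair_le_right (j j' : Fin (r + 1)) : Zop ι ({j} ∪ {j'}) ≤ Zop ι {j'} :=
  Zop_mono ι Finset.subset_union_right

/-! ## Extension of sections across the charts (Hartshorne II Lemma 5.14) -/

variable {ι G}

section ChartData

variable {i : Fin (r + 1)} {t : Γ(G, Zop ι {i})} {d : ℕ} {x : ∀ j : Fin (r + 1), Γ(G, Zop ι {j})}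

/-!
**Chart data of degree `d` extending `t ∈ Γ(Z_i, G)`** are sections `x_j ∈ Γ(Z_j, G)` with the
NUMERATOR equations `x_j = (x_i/x_j)^d · t` on `Z_j ∩ Z_i` and the COMPATIBILITY equations
`x_j = (x_{j'}/x_j)^d · x_{j'}` on `Z_{{j} ∪ {j'}} = Z_j ∩ Z_{j'}`: exactly a global section of `G(d)` whose
`i`-th chart value is `t`. The two systems of equations are spelled out in each statement below.
-/

/-- **Raising the degree, numerator equations**: if `x_j = (x_i/x_j)^d t` on `Z_j ∩ Z_i` then
`(x_i/x_j)^e x_j = (x_i/x_j)^(d+e) t` there. [folklore] -/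
theorem numer_pow_smul
    (hn : ∀ j : Fin (r + 1),
      G.presheaf.map (homOfLE (inf_le_left : Zop ι {j} ⊓ Zop ι {i} ≤ Zop ι {j})).op (x j) =
        Z.presheaf.map (homOfLE (inf_le_left : Zop ι {j} ⊓ Zop ι {i} ≤ Zop ι {j})).op (chartFun ι i j) ^ d •
          G.presheaf.map (homOfLE (inf_le_right : Zop ι {j} ⊓ Zop ι {i} ≤ Zop ι {i})).op t)
    (e : ℕ) (j : Fin (r + 1)) :
    G.presheaf.map (homOfLE (inf_le_left : Zop ι {j} ⊓ Zop ι {i} ≤ Zop ι {j})).op (chartFun ι i j ^ e • x j) =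
      Z.presheaf.map (homOfLE (inf_le_left : Zop ι {j} ⊓ Zop ι {i} ≤ Zop ι {j})).op (chartFun ι i j) ^ (d + e) •
        G.presheaf.map (homOfLE (inf_le_right : Zop ι {j} ⊓ Zop ι {i} ≤ Zop ι {i})).op t := by
  rw [Scheme.Modules.map_smul, map_pow, hn j, smul_smul, ← pow_add, Nat.add_comm e d]

/-- **Raising the degree, compatibility equations**: if `x_j = (x_{j'}/x_j)^d x_{j'}` on `Z_j ∩ Z_{j'}` then
`(x_i/x_j)^e x_j = (x_{j'}/x_j)^(d+e) (x_i/x_{j'})^e x_{j'}` there, by the cocycle identity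
`x_i/x_j = (x_i/x_{j'})(x_{j'}/x_j)`. [folklore] -/
theorem compat_pow_smul
    (hc : ∀ j j' : Fin (r + 1),
      G.presheaf.map (homOfLE (Zop_pair_le_left ι j j')).op (x j) =
        Z.presheaf.map (homOfLE (Zop_pair_le_left ι j j')).op (chartFun ι j' j) ^ d •
          G.presheaf.map (homOfLE (Zop_pair_le_right ι j j')).op (x j'))
    (e : ℕ) (j j' : Fin (r + 1)) :
    G.presheaf.map (homOfLE (Zop_pair_le_left ι j j')).op (chartFun ι i j ^ e • x j) =
      Z.presheaf.map (homOfLE (Zop_pair_le_left ι j j')).op (chartFun ι j' j) ^ (d + e) •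
        G.presheaf.map (homOfLE (Zop_pair_le_right ι j j')).op (chartFun ι i j' ^ e • x j') := by
  rw [Scheme.Modules.map_smul, map_pow, hc j j', Scheme.Modules.map_smul, map_pow, smul_smul, smul_smul,
    chartFun_cocycle ι i j j' (Zop_pair_le_left ι j j') (Zop_pair_le_right ι j j')]
  congr 1
  ring

/-- Compatible chart data satisfy the transition rule of `G(d)` on every `V ⊆ Z_j ∩ Z_{j'}` (restrict the
compatibility equation from `Z_{{j} ∪ {j'}}`). [folklore] -/
theorem isTwistFamily_of_compat
    (hc : ∀ j j' : Fin (r + 1),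
      G.presheaf.map (homOfLE (Zop_pair_le_left ι j j')).op (x j) =
        Z.presheaf.map (homOfLE (Zop_pair_le_left ι j j')).op (chartFun ι j' j) ^ d •
          G.presheaf.map (homOfLE (Zop_pair_le_right ι j j')).op (x j')) :
    IsTwistFamily ι G d ⊤ fun j =>
      G.presheaf.map (homOfLE (inf_le_right : ⊤ ⊓ Zop ι {j} ≤ Zop ι {j})).op (x j) := by
  intro j j' V hV hj hj'
  rw [moduleMap_map_apply, moduleMap_map_apply]
  have hV₀ : V ≤ Zop ι ({j} ∪ {j'}) := le_Zop_union ι hj hj'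
  have key := congrArg (G.presheaf.map (homOfLE hV₀).op) (hc j j')
  rw [moduleMap_map_apply, Scheme.Modules.map_smul, map_pow, moduleMap_map_apply,
    IsTwistSection.map_map_apply] at key
  exact key

/-- **Chart data of degree `d` extending `t` give a global section `g ∈ Γ(Z, G(d))` with `i`-th chart
value `t`**: `(g)_i|_V = t|_V` for every `V ⊆ Z_i` (the numerator equation at `j = i` reads `x_i = t`,
as `x_i/x_i = 1`). [folklore] -/
theorem exists_comp_eq_of_chartData
    (hn : G.presheaf.map (homOfLE (inf_le_left : Zop ι {i} ⊓ Zop ι {i} ≤ Zop ι {i})).op (x i) =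
      Z.presheaf.map (homOfLE (inf_le_left : Zop ι {i} ⊓ Zop ι {i} ≤ Zop ι {i})).op (chartFun ι i i) ^ d •
        G.presheaf.map (homOfLE (inf_le_right : Zop ι {i} ⊓ Zop ι {i} ≤ Zop ι {i})).op t)
    (hc : ∀ j j' : Fin (r + 1),
      G.presheaf.map (homOfLE (Zop_pair_le_left ι j j')).op (x j) =
        Z.presheaf.map (homOfLE (Zop_pair_le_left ι j j')).op (chartFun ι j' j) ^ d •
          G.presheaf.map (homOfLE (Zop_pair_le_right ι j j')).op (x j')) :
    ∃ g : Γ(twistMod ι G d, ⊤), ∀ ⦃V : Z.Opens⦄ (hV : V ≤ Zop ι {i}),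
      G.presheaf.map (homOfLE (le_inf le_top hV)).op (comp ι G g i) = G.presheaf.map (homOfLE hV).op t := by
  refine ⟨mkFamily ι G _ (isTwistFamily_of_compat hc), fun V hV => ?_⟩
  rw [comp_mkFamily, moduleMap_map_apply]
  rw [chartFun_self, map_one, one_pow, one_smul] at hn
  have key := congrArg (G.presheaf.map (homOfLE (le_inf hV hV : V ≤ Zop ι {i} ⊓ Zop ι {i})).op) hn
  rw [moduleMap_map_apply, moduleMap_map_apply] at key
  exact key

end ChartData

/-- A numerator equation `x|_{Z_j ∩ Z_i} = (x_i/x_j)^n · t|_{Z_j ∩ Z_i}` restricted to `V ⊆ Z_j ∩ Z_i`.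
[folklore] -/
theorem numer_restrict {i j : Fin (r + 1)} {t : Γ(G, Zop ι {i})} {n : ℕ} {x : Γ(G, Zop ι {j})}
    (hx : G.presheaf.map (homOfLE (inf_le_left : Zop ι {j} ⊓ Zop ι {i} ≤ Zop ι {j})).op x =
      Z.presheaf.map (homOfLE (inf_le_left : Zop ι {j} ⊓ Zop ι {i} ≤ Zop ι {j})).op (chartFun ι i j) ^ n •
        G.presheaf.map (homOfLE (inf_le_right : Zop ι {j} ⊓ Zop ι {i} ≤ Zop ι {i})).op t)
    {V : Z.Opens} (hVj : V ≤ Zop ι {j}) (hVi : V ≤ Zop ι {i}) :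
    G.presheaf.map (homOfLE hVj).op x =
      Z.presheaf.map (homOfLE hVj).op (chartFun ι i j) ^ n • G.presheaf.map (homOfLE hVi).op t := by
  have e := congrArg (G.presheaf.map (homOfLE (le_inf hVj hVi : V ≤ Zop ι {j} ⊓ Zop ι {i})).op) hx
  rw [moduleMap_map_apply, Scheme.Modules.map_smul, map_pow, moduleMap_map_apply,
    IsTwistSection.map_map_apply] at e
  exact e

variable (ι G)

/-- **Existence of chart data (Hartshorne II Lemma 5.14 for the sheaf `G` and the section `x_i` of
`𝒪(1)`)**: for `G` affine-localizing and `t ∈ Γ(Z_i, G)` there are `d` and `x_j ∈ Γ(Z_j, G)` with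
`x_j = (x_i/x_j)^d t` on `Z_j ∩ Z_i` and `x_j = (x_{j'}/x_j)^d x_{j'}` on `Z_j ∩ Z_{j'}`: numerators of `t` on
the affine `Z_j ⊇ D(x_i/x_j) = Z_j ∩ Z_i`, a uniform exponent, and a correction by a uniform power of
`x_i/x_j` killing the differences on the affine `Z_{{j,j'}}` (torsion property: they vanish on
`D(x_i/x_j) = Z_{{j,j'}} ∩ Z_i`). [cite: Hartshorne1977, II Lemma 5.14 (p. 118)] -/
theorem exists_chartData [IsAffineHom ι] (hG : IsAffineLocalizing G) (i : Fin (r + 1))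
    (t : Γ(G, Zop ι {i})) :
    ∃ (d : ℕ) (x : ∀ j : Fin (r + 1), Γ(G, Zop ι {j})),
      (∀ j : Fin (r + 1),
        G.presheaf.map (homOfLE (inf_le_left : Zop ι {j} ⊓ Zop ι {i} ≤ Zop ι {j})).op (x j) =
          Z.presheaf.map (homOfLE (inf_le_left : Zop ι {j} ⊓ Zop ι {i} ≤ Zop ι {j})).op (chartFun ι i j) ^ d •
            G.presheaf.map (homOfLE (inf_le_right : Zop ι {j} ⊓ Zop ι {i} ≤ Zop ι {i})).op t) ∧
      (∀ j j' : Fin (r + 1),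
        G.presheaf.map (homOfLE (Zop_pair_le_left ι j j')).op (x j) =
          Z.presheaf.map (homOfLE (Zop_pair_le_left ι j j')).op (chartFun ι j' j) ^ d •
            G.presheaf.map (homOfLE (Zop_pair_le_right ι j j')).op (x j')) := by
  classical
  -- Step A: numerators of `t` on each affine chart `Z_j ⊇ Z_j ∩ Z_i = D(x_i/x_j)`
  have hA : ∀ j : Fin (r + 1), ∃ (n : ℕ) (x : Γ(G, Zop ι {j})),
      G.presheaf.map (homOfLE (inf_le_left : Zop ι {j} ⊓ Zop ι {i} ≤ Zop ι {j})).op x =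
        Z.presheaf.map (homOfLE (inf_le_left : Zop ι {j} ⊓ Zop ι {i} ≤ Zop ι {j})).op (chartFun ι i j) ^ n •
          G.presheaf.map (homOfLE (inf_le_right : Zop ι {j} ⊓ Zop ι {i} ≤ Zop ι {i})).op t := by
    intro j
    obtain ⟨n, x, hx⟩ := hG.numerator (isAffineOpen_Zop ι (Finset.singleton_nonempty j)) (chartFun ι i j)
      (Zop_singleton_inf_eq_basicOpen ι i j) (G.presheaf.map (homOfLE inf_le_right).op t)
    exact ⟨n, x, hx⟩
  choose n x hx using hA
  -- Step B: a uniform exponent `n₁`, numerators `x₁ j = (x_i/x_j)^(n₁ - n j) · x j`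
  obtain ⟨n₁, hle⟩ : ∃ n₁ : ℕ, ∀ j, n j ≤ n₁ :=
    ⟨Finset.univ.sup n, fun j => Finset.le_sup (f := n) (Finset.mem_univ j)⟩
  obtain ⟨x₁, hx₁⟩ : ∃ x₁ : ∀ j : Fin (r + 1), Γ(G, Zop ι {j}), ∀ j,
      G.presheaf.map (homOfLE (inf_le_left : Zop ι {j} ⊓ Zop ι {i} ≤ Zop ι {j})).op (x₁ j) =
        Z.presheaf.map (homOfLE (inf_le_left : Zop ι {j} ⊓ Zop ι {i} ≤ Zop ι {j})).op (chartFun ι i j) ^ n₁ •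
          G.presheaf.map (homOfLE (inf_le_right : Zop ι {j} ⊓ Zop ι {i} ≤ Zop ι {i})).op t :=
    ⟨fun j => chartFun ι i j ^ (n₁ - n j) • x j, fun j => by
      rw [Scheme.Modules.map_smul, map_pow, hx j, smul_smul, ← pow_add, Nat.sub_add_cancel (hle j)]⟩
  clear hx hle x n
  -- Step C: the differences on `Z_{{j,j'}}` vanish on `D(x_i/x_j)`, hence are killed by a power of `x_i/x_j`
  have hC : ∀ j j' : Fin (r + 1), ∃ k : ℕ,
      Z.presheaf.map (homOfLE (Zop_pair_le_left ι j j')).op (chartFun ι i j) ^ k •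
        (G.presheaf.map (homOfLE (Zop_pair_le_left ι j j')).op (x₁ j) -
          Z.presheaf.map (homOfLE (Zop_pair_le_left ι j j')).op (chartFun ι j' j) ^ n₁ •
            G.presheaf.map (homOfLE (Zop_pair_le_right ι j j')).op (x₁ j')) = 0 := by
    intro j j'
    refine hG.torsion (isAffineOpen_Zop ι ⟨j, Finset.mem_union_left _ (Finset.mem_singleton_self j)⟩)
      (Z.presheaf.map (homOfLE (Zop_pair_le_left ι j j')).op (chartFun ι i j)) _
      (W := Zop ι ({j} ∪ {j'}) ⊓ Zop ι {i}) inf_le_left ?_ ?_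
    · rw [Scheme.basicOpen_res]
      exact inf_le_inf_left _ ((Zop_singleton_inf_eq_basicOpen ι i j).ge.trans inf_le_right)
    · rw [map_sub, sub_eq_zero, Scheme.Modules.map_smul, map_pow, moduleMap_map_apply, moduleMap_map_apply,
        IsTwistSection.map_map_apply,
        numer_restrict (hx₁ j) ((inf_le_left : Zop ι ({j} ∪ {j'}) ⊓ Zop ι {i} ≤ _).trans (Zop_pair_le_left ι j j'))
          inf_le_right,
        numer_restrict (hx₁ j') ((inf_le_left : Zop ι ({j} ∪ {j'}) ⊓ Zop ι {i} ≤ _).trans (Zop_pair_le_right ι j j'))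
          inf_le_right,
        smul_smul, ← mul_pow,
        chartFun_cocycle ι i j j' ((inf_le_left : Zop ι ({j} ∪ {j'}) ⊓ Zop ι {i} ≤ _).trans (Zop_pair_le_left ι j j'))
          ((inf_le_left : Zop ι ({j} ∪ {j'}) ⊓ Zop ι {i} ≤ _).trans (Zop_pair_le_right ι j j')), mul_comm]
  choose k hk using hC
  obtain ⟨K, hkK⟩ : ∃ K : ℕ, ∀ j j', k j j' ≤ K :=
    ⟨Finset.univ.sup fun p : Fin (r + 1) × Fin (r + 1) => k p.1 p.2, fun j j' =>
      Finset.le_sup (f := fun p : Fin (r + 1) × Fin (r + 1) => k p.1 p.2) (Finset.mem_univ (j, j'))⟩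
  -- Step D: the corrected data `(x_i/x_j)^K · x₁ j` of degree `n₁ + K`
  refine ⟨n₁ + K, fun j => chartFun ι i j ^ K • x₁ j, numer_pow_smul hx₁ K, fun j j' => ?_⟩
  · have h1 : Z.presheaf.map (homOfLE (Zop_pair_le_left ι j j')).op (chartFun ι i j) ^ K •
        (G.presheaf.map (homOfLE (Zop_pair_le_left ι j j')).op (x₁ j) -
          Z.presheaf.map (homOfLE (Zop_pair_le_left ι j j')).op (chartFun ι j' j) ^ n₁ •
            G.presheaf.map (homOfLE (Zop_pair_le_right ι j j')).op (x₁ j')) = 0 := by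
      rw [← Nat.sub_add_cancel (hkK j j'), pow_add, mul_smul, hk j j', smul_zero]
    rw [smul_sub, sub_eq_zero] at h1
    rw [Scheme.Modules.map_smul, map_pow, h1, Scheme.Modules.map_smul, map_pow, smul_smul, smul_smul,
      chartFun_cocycle ι i j j' (Zop_pair_le_left ι j j') (Zop_pair_le_right ι j j')]
    congr 1
    ring

/-- **Extension of sections in all large degrees**: for `G` affine-localizing and `t ∈ Γ(Z_i, G)` there is
`n₀` such that for every `n ≥ n₀` some global section `g ∈ Γ(Z, G(n))` has `i`-th chart value `t`
(`(g)_i|_V = t|_V` for all `V ⊆ Z_i`; informally `g = x_i^n t`). [cite: Hartshorne1977, II Lemma 5.14 (b)] -/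
theorem exists_forall_comp_eq [IsAffineHom ι] (hG : IsAffineLocalizing G) (i : Fin (r + 1))
    (t : Γ(G, Zop ι {i})) :
    ∃ n₀ : ℕ, ∀ n : ℕ, n₀ ≤ n → ∃ g : Γ(twistMod ι G n, ⊤), ∀ ⦃V : Z.Opens⦄ (hV : V ≤ Zop ι {i}),
      G.presheaf.map (homOfLE (le_inf le_top hV)).op (comp ι G g i) = G.presheaf.map (homOfLE hV).op t := by
  obtain ⟨d, x, hn, hc⟩ := exists_chartData ι G hG i t
  refine ⟨d, fun n hdn => ?_⟩
  obtain ⟨e, rfl⟩ := Nat.exists_eq_add_of_le hdn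
  exact exists_comp_eq_of_chartData (numer_pow_smul hn e i) (compat_pow_smul hc e)

/-! ## Serre's theorem A -/

/-- **Serre's theorem A, chart form** (Hartshorne II Thm. 5.17, after Serre's FAC): for a closed subscheme
`ι : Z ↪ 𝐏ʳ_A` and a coherent `𝒪_Z`-module `G` there is `m₀` such that for every `m ≥ m₀` finitely many
global sections `g_0, …, g_N` of the twist `G(m)` have `i₀`-th chart values generating `Γ(Z_s, G)` over
`Γ(Z_s, 𝒪_Z)` for every `s ∋ i₀`: extend finite generating families of the `Γ(Z_i, G)` (affine charts,
`G` of affine-finite type) to global sections of `G(m)` (`exists_forall_comp_eq`), and descend from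
`Z_{i₀}` to its basic open `Z_s = D(u)` by numerators, `u` being a unit on `Z_s`.
[cite: Hartshorne1977, II Thm. 5.17 (p. 121)] -/
theorem exists_generators [IsClosedImmersion ι] (hG : Coh G) :
    ∃ m₀ : ℕ, ∀ m : ℕ, m₀ ≤ m → ∃ (N : ℕ) (g : Fin (N + 1) → Γ(twistMod ι G m, ⊤)),
      ∀ (s : Finset (Fin (r + 1))) (i₀ : Fin (r + 1)) (hi₀ : i₀ ∈ s) (t : Γ(G, Zop ι s)),
        t ∈ Submodule.span Γ(Z, Zop ι s) (Set.range fun j => G.presheaf.map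
          (homOfLE (le_inf le_top (Zop_mono ι (Finset.singleton_subset_iff.mpr hi₀)))).op (comp ι G (g j) i₀)) := by
  classical
  -- finite generating families on the affine charts
  choose S hS using fun i : Fin (r + 1) =>
    Module.finite_def.mp (hG.ft (isAffineOpen_Zop ι (Finset.singleton_nonempty i)))
  -- extension degrees of all sections of all charts
  choose n₀ hn₀ using fun (i : Fin (r + 1)) (t : Γ(G, Zop ι {i})) => exists_forall_comp_eq ι G hG.loc i t
  refine ⟨Finset.univ.sup fun i => (S i).sup (n₀ i), fun m hm => ?_⟩
  have hle : ∀ i, ∀ t ∈ S i, n₀ i t ≤ m := fun i t ht =>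
    le_trans (le_trans (Finset.le_sup (f := n₀ i) ht)
      (Finset.le_sup (f := fun i => (S i).sup (n₀ i)) (Finset.mem_univ i))) hm
  -- the global sections extending the generators, indexed by `Fin (N + 1)`
  let T : Type u := Σ i : Fin (r + 1), (S i : Set Γ(G, Zop ι {i}))
  choose gT hgT using fun p : T => hn₀ p.1 p.2.1 m (hle p.1 p.2.1 p.2.2)
  let eT := Fintype.equivFin T
  refine ⟨Fintype.card T, Fin.cons 0 fun j => gT (eT.symm j), fun s i₀ hi₀ t => ?_⟩
  -- generation on `Z_s = D(u) ⊆ Z_{i₀}`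
  have hsi : Zop ι s ≤ Zop ι {i₀} := Zop_mono ι (Finset.singleton_subset_iff.mpr hi₀)
  set u : Γ(Z, Zop ι {i₀}) := show Γ(Z, Zop ι {i₀}) from evalRing ι {i₀} (tElB A s i₀) with hudef
  have hu : Zop ι s = Z.basicOpen u := Zop_eq_basicOpen_of_mem ι hi₀
  obtain ⟨a, y, hy⟩ := hG.loc.numerator (isAffineOpen_Zop ι (Finset.singleton_nonempty i₀)) u hu t
  have hy' : G.presheaf.map (homOfLE hsi).op y = Z.presheaf.map (homOfLE hsi).op u ^ a • t := hy
  have hunit : ∀ {W : Z.Opens} (_ : W = Z.basicOpen u) (h : W ≤ Zop ι {i₀}),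
      IsUnit (Z.presheaf.map (homOfLE h).op u) := by
    rintro W rfl h
    exact Z.toRingedSpace.isUnit_res_basicOpen u
  obtain ⟨w, hw⟩ := ((hunit hu hsi).pow a).exists_left_inv
  have ht : t = w • G.presheaf.map (homOfLE hsi).op y := by rw [hy', smul_smul, hw, one_smul]
  rw [ht]
  refine Submodule.smul_mem _ _ ?_
  have hymem : y ∈ Submodule.span Γ(Z, Zop ι {i₀}) (S i₀ : Set Γ(G, Zop ι {i₀})) := by
    rw [hS i₀]; trivial
  refine Submodule.span_induction (p := fun y _ => G.presheaf.map (homOfLE hsi).op y ∈ _) ?_ ?_ ?_ ?_ hymem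
  · intro t' ht'
    refine Submodule.subset_span ⟨(eT ⟨i₀, ⟨t', ht'⟩⟩).succ, ?_⟩
    dsimp only
    rw [Fin.cons_succ, Equiv.symm_apply_apply]
    exact hgT ⟨i₀, ⟨t', ht'⟩⟩ hsi
  · rw [map_zero]; exact Submodule.zero_mem _
  · intro a b _ _ ha hb
    rw [map_add]; exact Submodule.add_mem _ ha hb
  · intro c a _ ha
    rw [Scheme.Modules.map_smul]; exact Submodule.smul_mem _ _ ha

end SerreTwist

end Literature.AlgebraicGeometry.Modules

end
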